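import Literature.Barriers.Schanuel.LargeTranscendenceDegreeThm29Proofs
import Literature.NumberTheory.Transcendental.ExpSmallTrdegProofs
import Literature.NumberTheory.Transcendental.ExpSmallTrdegProofsI
import Literature.NumberTheory.Transcendental.ExpSmallTrdegProofsIV
import HarnessLib

/-!
# Small transcendence degree on the `d × ℓ` grid (LNM 1752, Ch. 14, Theorem 2.9) — unconditional

Discharge of the named fact `Literature.Barriers.Schanuel.smallTrdeg_thm_2_9_pos`
(`LargeTranscendenceDegree.lean`): for `d, ℓ ≥ 1` and `ℚ`-linearly independent
`x₁, …, x_d`, `y₁, …, y_ℓ`, with `K = ℚ(e^{xᵢyⱼ})`, `K₁ = K(x)`, `K₂ = K₁(y)`: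
`dℓ ≥ 2(ℓ + d) ⇒ trdeg K ≥ 2`, `dℓ ≥ d + 2ℓ ⇒ trdeg K₁ ≥ 2`, `dℓ > ℓ + d ⇒ trdeg K₂ ≥ 2`.

The three clauses are Theorem 3.1 (i), (iii), (iv) of LNM 1752, Ch. 13 (M. Laurent), which are
proved in the tree (`Literature.NumberTheory.Transcendental.Laurent2001_thm_3_1_i_holds`,
`…_iii_holds`, `…_iv_holds`, files `ExpSmallTrdegProofsI.lean`, `ExpSmallTrdegProofs.lean`,
`ExpSmallTrdegProofsIV.lean`); the assembly `smallTrdeg_thm_2_9_pos_of_thm_3_1`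
(`LargeTranscendenceDegreeThm29Proofs.lean`) was already proved, so this file only composes.
As a corollary the `t₂`-clause holds with no positivity hypothesis
(`two_le_trdeg_gridField₂`), i.e. the proved reach `t₂ ≥ 2` of the several-variables method
recorded by the barrier `Literature.Barriers.Schanuel.LargeTranscendenceDegree` is now a theorem
of the tree rather than a hypothesis.

## References

* [NesterenkoPhilippon2001] Yu. V. Nesterenko, P. Philippon (eds.), *Introduction to Algebraic
  Independence Theory*, LNM 1752 (2001), Ch. 13 Theorem 3.1 (PDF p. 233); Ch. 14 Theorem 2.9
  (PDF p. 249).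
* [BakerTNT1975] A. Baker, *Transcendental Number Theory*, Cambridge Univ. Press (1975), Ch. 12,
  Theorems 12.1–12.2 and §5, pp. 110–118.
-/

noncomputable section

open Literature.NumberTheory.Transcendental

namespace Literature.Barriers.Schanuel

/-- **LNM 1752, Ch. 14, Theorem 2.9 (small transcendence degree without any Technical
Hypothesis), PROVED**: the named fact `smallTrdeg_thm_2_9_pos` holds — composition of the proved
assembly `smallTrdeg_thm_2_9_pos_of_thm_3_1` with the tree's proofs of Ch. 13 Theorem 3.1 (i),
(iii), (iv) (Gel'fond / Schneider methods on `𝔾ₐ × 𝔾ₘᵐ` with Tijdeman's zero estimate and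
Gel'fond's criterion). [cite: NesterenkoPhilippon2001, Ch. 14 Theorem 2.9; Ch. 13 Theorem 3.1 (i), (iii), (iv)]
[cite: BakerTNT1975, Ch. 12 Theorems 12.1–12.2] -/
theorem smallTrdeg_thm_2_9_pos_holds : smallTrdeg_thm_2_9_pos :=
  smallTrdeg_thm_2_9_pos_of_thm_3_1 Laurent2001_thm_3_1_i_holds Laurent2001_thm_3_1_iii_holds
    Laurent2001_thm_3_1_iv_holds

/-- **Unconditional `t₂ ≥ 2` on the grid** (LNM 1752, Ch. 14, Theorem 2.9, `t₂`-clause;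
Brownawell 1974 / Waldschmidt 1973): for `ℚ`-linearly independent `x : Fin d → ℂ`,
`y : Fin ℓ → ℂ` with `ℓ + d < dℓ`, `trdeg_ℚ ℚ(x, y, e^{xᵢyⱼ}) ≥ 2` — the clause of
`smallTrdeg_thm_2_9_pos` whose numerology forces `d, ℓ ≥ 1`
(`smallTrdeg_thm_2_9_pos.two_le_trdeg_gridField₂`), now free of hypotheses. This is the proved
reach, at transcendence degree `2`, of the route thesis `CartesianSchanuelThesis` of
`Summits/Schanuel/Schanuel/Theses/AlgIndepMethod.lean` (which asks for `dℓ`).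
[cite: NesterenkoPhilippon2001, Ch. 14 Theorem 2.9 (t₂)] -/
theorem two_le_trdeg_gridField₂ {d l : ℕ} (x : Fin d → ℂ) (y : Fin l → ℂ)
    (hx : LinearIndependent ℚ x) (hy : LinearIndependent ℚ y) (hdl : l + d < d * l) :
    (2 : Cardinal) ≤ Algebra.trdeg ℚ (gridField₂ x y) :=
  smallTrdeg_thm_2_9_pos_holds.two_le_trdeg_gridField₂ x y hx hy hdl

end Literature.Barriers.Schanuel

end
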